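import Summits.QuantumFields.BalabanUV.Beta.D1BFx.GhostDeficitFormula

/-!
# `BalabanUV.Beta.D1BFx.GhostBracketGaugeSplit` — road «BF-x» for binder row D1, slot (K), junction (J3), ROUTE M of TB5-1′ ((C3) structure),
# FILE C3: **THE FOUR `Q′`-WORDS AT THE ROAD's DRESSED WEIGHTS = THE UNDRESSED ONES + THE GAUGE VARIATION OF THE `D*D`-ONLY WORD**, and
# **the undressed ones are the `cQ`-defect of the END's `PghQ`**:
# `BR[colH G₀] μ ν z = BR[colH K₀] μ ν z + (DD[colH K₀] μ ν z − DD[colH G₀] μ ν z)`, `BR[colH K₀] μ ν z = PghQ n a (−1) n² a μ ν z − PghQ n a (−1) n² 0 μ ν z`.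

WHY (journal [D1LEAF04-G22-ONLINE]; gan24-leaf-05 g55 W-2 «the STRUCTURE of record the n⁸ question will want»): `BR[colH G₀]` = the bracket of the OWNER's
«RJ3 FORMULA» (`GhostDeficitFormula.road_ghost_word_eq`: road ghost word `= −2·PghQ(unit) + 2·BR`).  Leaf-04 g21's GHOST WORD SPLIT (F7
`PackedWordSplit.ghost_word_split`: completed word = `D*D`-only word + `BR`, at ANY weight family) at both weight families and WORD-LEVEL TRANSVERSALITY
(F6 `GhostWardWord.ghost_word_dressed_eq_undressed` at `c = 1`: the completed word is the same at both) give the first identity by subtraction; F6's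
`hessKer_K₀_packed_eq_TOfGh` (twice) gives the second (`= −½·ΔGH` of g18's `GhostDeltaWords.deltaGH_eq_words`, a (1.22)-vanishing row by
`RestKernelGhostDelta.abs_secondMoment_deltaGH_le`).  The gauge variation `DD[colH K₀] − DD[colH G₀]` is computed in FILE C2 (`GhostLoopGaugeVariation`):
two resp. four χ-words, each with a frozen-averaging factor `[P_a, χ̂]`.

CONTENT (all [folklore]; `n = m+1`, `r ∈ box 4 n`, `0 < a`, unit ray `(x₀, cK, cQ) = (−1, n², a)`, stencil root `ctrHalf n`; `BR[w]` spelled exactly as in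
`GhostDeficitFormula` ∕ PART 16): **`BR_G₀_eq_BR_K₀_add`**, **`BR_K₀_eq_PghQ_sub`**.

HONEST DEPENDENCY (cell records, verbatim): «continuum YM on T⁴ ⇐ BetaPertH ∧ nine spine estimates (0/9 proved); BetaPertH ⇐ (D1) ∧ (D4) ∧
CAP+tail; G-an2-4 gates asym, D1 and NE2/3/4.»  HONEST FRAMING (cell contract, verbatim): «discharging `BetaPertH` makes Bałaban's UV stability
UNCONDITIONAL — a real constructive-QFT result; it is NOT the continuum limit and NOT the Clay problem.»  THIS MODULE DISCHARGES NOTHING of (K),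
of D1 or of the wall: [folklore] composition BY NAME of F6∕F7 (linear arithmetic); no estimate, no row; nothing of Bałaban's asserted.  No definition,
no `def … : Prop`, nothing cited, 0 sorry.  0 root-level binders of row D1 discharged; (J3) DISPLAYED; (K) NOT closed; NOT D1, NOT `BetaPertH`,
NOT continuum, NOT Clay.
ABSOLUTE RULE (cell charter, verbatim): «No internally-minted statement may enter as a cited fact. Every hypothesis is either kernel-proved in this
package or a verbatim quotation of a PUBLISHED theorem with page reference. The manuscript(s) under audit are NOT citable for their own disputed
steps — they are the thing under adjudication; programme-internal (2001/route/tribunal) claims are never citable.»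
Unit `b2b-balaban-beta-d1-formalise-leaf-04` (gen 22), D1 formalisation swarm leaf prover 04, road «BF-x»; ROUTE M (C3) structure, FILE C3 (journal [D1LEAF04-G22-*]).
-/

noncomputable section

namespace Summit.QuantumFields.BalabanUV.Beta.D1BFx.GhostBracketGaugeSplit

open Finset
open scoped BigOperators
open Literature.MathematicalPhysics.QuantumFieldTheory.Balaban1983to89
open Literature.MathematicalPhysics.QuantumFieldTheory.Balaban1983to89.Beta
open ExpKernelCalculus (Site MKer hessKer bubble tadpole)
open AffineAveraging (box toSite)
open OneStepKernelFamily (KInvStep colH)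
open OneStepResolventKernel (wsum)
open Summit.QuantumFields.BalabanUV.Beta.AxialDressingRooted (coDressKBmAt)
open Summit.QuantumFields.BalabanUV.Beta.D1BFx.GhostLeg (Ggh)
open Summit.QuantumFields.BalabanUV.Beta.D1BFx.GhostStencil (ghCur)
open Summit.QuantumFields.BalabanUV.Beta.D1BFx.GhostStencilReflection (ghX)
open Summit.QuantumFields.BalabanUV.Beta.D1BFx.GhostStencilRooted (SghAt qAntiAt)
open Summit.QuantumFields.BalabanUV.Beta.D1BFx.GhostStencilRootedReflection (ctrHalf ctrHalf_mem)
open Summit.QuantumFields.BalabanUV.Beta.D1BFx.GhostAveragingSquare (WghAt qSqAt)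
open Summit.QuantumFields.BalabanUV.Beta.D1BFx.ReducedKernelSandwichBlock (diagExt)
open Summit.QuantumFields.BalabanUV.Beta.D1BFx.GhostKernelComplete (PghQ)
open Summit.QuantumFields.BalabanUV.Beta.D1BFx.PackedWordSplit (ghost_word_split)
open Summit.QuantumFields.BalabanUV.Beta.D1BFx.GhostWardWord (ghost_word_dressed_eq_undressed abs_colH_K₀_road_le_l1 colH_K₀_road_weight_nonneg road_rate_pos
  hessKer_K₀_packed_eq_TOfGh)
open Summit.QuantumFields.BalabanUV.Beta.D1BFx.PackedColumnEnvelope (abs_colH_G₀_road_le colH_G₀_road_weight_nonneg)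

variable (m : ℕ) {a : ℝ} {r : Fin (3 + 1) → ℕ} (hr : r ∈ box (3 + 1) (m + 1)) (ha : 0 < a)


include hr ha in
/-- [folklore] **`BR[colH G₀] = BR[colH K₀] + (DD[colH K₀] − DD[colH G₀])`**: leaf-04 g21's GHOST WORD SPLIT (`PackedWordSplit.ghost_word_split`,
unit ray `(x₀, cK, cQ) = (−1, n², a)`, stencil root `ctrHalf n`) at BOTH weight families + WORD-LEVEL TRANSVERSALITY (`GhostWardWord.ghost_word_dressed_eq_undressed`
at `c = 1`: the completed word is the same at both weights).  `BR[w]` is written exactly as in the OWNER's `GhostDeficitFormula` ∕ PART 16 (`w = colH G₀`). -/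
theorem BR_G₀_eq_BR_K₀_add (μ ν : Fin 4) (z : Site 4) :
    ((1 / 2) * tadpole (Ggh (m + 1) a) (∑ κ : Fin 4, ∑ l : Fin 4,
          wsum (colH (coDressKBmAt (toSite r) (m + 1) (KInvStep (d := 3) (m + 1) 0)) (m + 1) μ 0 κ)
            (fun u => wsum (colH (coDressKBmAt (toSite r) (m + 1) (KInvStep (d := 3) (m + 1) 0)) (m + 1) ν z l)
              (fun v' => (-((-1) * a * ((m + 1 : ℕ) : ℝ) ^ 4)) • qSqAt (ctrHalf (m + 1)) (m + 1) κ u l v')))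
        - (1 / 2) * (bubble (Ggh (m + 1) a)
              (∑ κ : Fin 4, wsum (colH (coDressKBmAt (toSite r) (m + 1) (KInvStep (d := 3) (m + 1) 0)) (m + 1) μ 0 κ)
                (fun u => (((m + 1 : ℕ) : ℝ) ^ 2) • ghCur κ u))
              (∑ κ : Fin 4, wsum (colH (coDressKBmAt (toSite r) (m + 1) (KInvStep (d := 3) (m + 1) 0)) (m + 1) ν z κ)
                (fun u => a • qAntiAt (ctrHalf (m + 1)) (m + 1) κ u))
            + bubble (Ggh (m + 1) a)
              (∑ κ : Fin 4, wsum (colH (coDressKBmAt (toSite r) (m + 1) (KInvStep (d := 3) (m + 1) 0)) (m + 1) μ 0 κ)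
                (fun u => a • qAntiAt (ctrHalf (m + 1)) (m + 1) κ u))
              (∑ κ : Fin 4, wsum (colH (coDressKBmAt (toSite r) (m + 1) (KInvStep (d := 3) (m + 1) 0)) (m + 1) ν z κ)
                (fun u => (((m + 1 : ℕ) : ℝ) ^ 2) • ghCur κ u))
            + bubble (Ggh (m + 1) a)
              (∑ κ : Fin 4, wsum (colH (coDressKBmAt (toSite r) (m + 1) (KInvStep (d := 3) (m + 1) 0)) (m + 1) μ 0 κ)
                (fun u => a • qAntiAt (ctrHalf (m + 1)) (m + 1) κ u))
              (∑ κ : Fin 4, wsum (colH (coDressKBmAt (toSite r) (m + 1) (KInvStep (d := 3) (m + 1) 0)) (m + 1) ν z κ)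
                (fun u => a • qAntiAt (ctrHalf (m + 1)) (m + 1) κ u))))
      = ((1 / 2) * tadpole (Ggh (m + 1) a) (∑ κ : Fin 4, ∑ l : Fin 4,
            wsum (colH (KInvStep (d := 3) (m + 1) 0) (m + 1) μ 0 κ)
              (fun u => wsum (colH (KInvStep (d := 3) (m + 1) 0) (m + 1) ν z l)
                (fun v' => (-((-1) * a * ((m + 1 : ℕ) : ℝ) ^ 4)) • qSqAt (ctrHalf (m + 1)) (m + 1) κ u l v')))
          - (1 / 2) * (bubble (Ggh (m + 1) a)
                (∑ κ : Fin 4, wsum (colH (KInvStep (d := 3) (m + 1) 0) (m + 1) μ 0 κ) (fun u => (((m + 1 : ℕ) : ℝ) ^ 2) • ghCur κ u))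
                (∑ κ : Fin 4, wsum (colH (KInvStep (d := 3) (m + 1) 0) (m + 1) ν z κ) (fun u => a • qAntiAt (ctrHalf (m + 1)) (m + 1) κ u))
              + bubble (Ggh (m + 1) a)
                (∑ κ : Fin 4, wsum (colH (KInvStep (d := 3) (m + 1) 0) (m + 1) μ 0 κ) (fun u => a • qAntiAt (ctrHalf (m + 1)) (m + 1) κ u))
                (∑ κ : Fin 4, wsum (colH (KInvStep (d := 3) (m + 1) 0) (m + 1) ν z κ) (fun u => (((m + 1 : ℕ) : ℝ) ^ 2) • ghCur κ u))
              + bubble (Ggh (m + 1) a)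
                (∑ κ : Fin 4, wsum (colH (KInvStep (d := 3) (m + 1) 0) (m + 1) μ 0 κ) (fun u => a • qAntiAt (ctrHalf (m + 1)) (m + 1) κ u))
                (∑ κ : Fin 4, wsum (colH (KInvStep (d := 3) (m + 1) 0) (m + 1) ν z κ) (fun u => a • qAntiAt (ctrHalf (m + 1)) (m + 1) κ u))))
        + (hessKer (Ggh (m + 1) a)
            (fun μ y => ∑ κ : Fin 4, wsum (colH (KInvStep (d := 3) (m + 1) 0) (m + 1) μ y κ) (fun u => (((m + 1 : ℕ) : ℝ) ^ 2) • ghCur κ u))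
            (fun μ y ν y' => ∑ κ : Fin 4, ∑ l : Fin 4, wsum (colH (KInvStep (d := 3) (m + 1) 0) (m + 1) μ y κ)
              (fun u => wsum (colH (KInvStep (d := 3) (m + 1) 0) (m + 1) ν y' l)
                (diagExt (fun μ y => ((-1) * ((m + 1 : ℕ) : ℝ) ^ 2) • ghX μ y) κ u l))) μ ν z
          - hessKer (Ggh (m + 1) a)
            (fun μ y => ∑ κ : Fin 4, wsum (colH (coDressKBmAt (toSite r) (m + 1) (KInvStep (d := 3) (m + 1) 0)) (m + 1) μ y κ)
              (fun u => (((m + 1 : ℕ) : ℝ) ^ 2) • ghCur κ u))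
            (fun μ y ν y' => ∑ κ : Fin 4, ∑ l : Fin 4, wsum (colH (coDressKBmAt (toSite r) (m + 1) (KInvStep (d := 3) (m + 1) 0)) (m + 1) μ y κ)
              (fun u => wsum (colH (coDressKBmAt (toSite r) (m + 1) (KInvStep (d := 3) (m + 1) 0)) (m + 1) ν y' l)
                (diagExt (fun μ y => ((-1) * ((m + 1 : ℕ) : ℝ) ^ 2) • ghX μ y) κ u l))) μ ν z) := by
  -- F7 at the dressed weights and at the undressed weights
  have hG := ghost_word_split (m + 1) ha (ctrHalf_mem (m + 1)) (-1) (((m + 1 : ℕ) : ℝ) ^ 2) a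
    (w := fun μ y κ => colH (coDressKBmAt (toSite r) (m + 1) (KInvStep (d := 3) (m + 1) 0)) (m + 1) μ y κ)
    (fun μ y κ u => abs_colH_G₀_road_le m hr μ y κ u) (colH_G₀_road_weight_nonneg m) (road_rate_pos m) μ ν z
  have hK := ghost_word_split (m + 1) ha (ctrHalf_mem (m + 1)) (-1) (((m + 1 : ℕ) : ℝ) ^ 2) a
    (w := fun μ y κ => colH (KInvStep (d := 3) (m + 1) 0) (m + 1) μ y κ)
    (fun μ y κ u => abs_colH_K₀_road_le_l1 m μ y κ u) (colH_K₀_road_weight_nonneg m) (road_rate_pos m) μ ν z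
  -- F6: the completed word is the same at both weights (`c = 1`)
  have hF := ghost_word_dressed_eq_undressed m hr (a := a) ha (ρ := ctrHalf (m + 1)) (ctrHalf_mem (m + 1)) (c := 1) μ ν z
  simp only [one_mul] at hF
  linarith [hG, hK, hF]

include ha in
/-- [folklore] **THE UNDRESSED FOUR `Q′`-WORDS ARE THE `cQ`-DEFECT OF THE END's `PghQ`** (`= −½·ΔGH` of g18's `GhostDeltaWords ∕ RestKernelGhostDelta`):
`BR[colH K₀] μ ν z = PghQ n a (−1) n² a μ ν z − PghQ n a (−1) n² 0 μ ν z` (`GhostWardWord.hessKer_K₀_packed_eq_TOfGh` twice). -/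
theorem BR_K₀_eq_PghQ_sub (μ ν : Fin 4) (z : Site 4) :
    ((1 / 2) * tadpole (Ggh (m + 1) a) (∑ κ : Fin 4, ∑ l : Fin 4,
            wsum (colH (KInvStep (d := 3) (m + 1) 0) (m + 1) μ 0 κ)
              (fun u => wsum (colH (KInvStep (d := 3) (m + 1) 0) (m + 1) ν z l)
                (fun v' => (-((-1) * a * ((m + 1 : ℕ) : ℝ) ^ 4)) • qSqAt (ctrHalf (m + 1)) (m + 1) κ u l v')))
          - (1 / 2) * (bubble (Ggh (m + 1) a)
                (∑ κ : Fin 4, wsum (colH (KInvStep (d := 3) (m + 1) 0) (m + 1) μ 0 κ) (fun u => (((m + 1 : ℕ) : ℝ) ^ 2) • ghCur κ u))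
                (∑ κ : Fin 4, wsum (colH (KInvStep (d := 3) (m + 1) 0) (m + 1) ν z κ) (fun u => a • qAntiAt (ctrHalf (m + 1)) (m + 1) κ u))
              + bubble (Ggh (m + 1) a)
                (∑ κ : Fin 4, wsum (colH (KInvStep (d := 3) (m + 1) 0) (m + 1) μ 0 κ) (fun u => a • qAntiAt (ctrHalf (m + 1)) (m + 1) κ u))
                (∑ κ : Fin 4, wsum (colH (KInvStep (d := 3) (m + 1) 0) (m + 1) ν z κ) (fun u => (((m + 1 : ℕ) : ℝ) ^ 2) • ghCur κ u))
              + bubble (Ggh (m + 1) a)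
                (∑ κ : Fin 4, wsum (colH (KInvStep (d := 3) (m + 1) 0) (m + 1) μ 0 κ) (fun u => a • qAntiAt (ctrHalf (m + 1)) (m + 1) κ u))
                (∑ κ : Fin 4, wsum (colH (KInvStep (d := 3) (m + 1) 0) (m + 1) ν z κ) (fun u => a • qAntiAt (ctrHalf (m + 1)) (m + 1) κ u))))
      = PghQ (m + 1) a (-1) (((m + 1 : ℕ) : ℝ) ^ 2) a μ ν z - PghQ (m + 1) a (-1) (((m + 1 : ℕ) : ℝ) ^ 2) 0 μ ν z := by
  have hK := ghost_word_split (m + 1) ha (ctrHalf_mem (m + 1)) (-1) (((m + 1 : ℕ) : ℝ) ^ 2) a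
    (w := fun μ y κ => colH (KInvStep (d := 3) (m + 1) 0) (m + 1) μ y κ)
    (fun μ y κ u => abs_colH_K₀_road_le_l1 m μ y κ u) (colH_K₀_road_weight_nonneg m) (road_rate_pos m) μ ν z
  -- the completed undressed word is `PghQ … a`
  have hFull := hessKer_K₀_packed_eq_TOfGh (m + 1) a (SghAt (ctrHalf (m + 1)) (m + 1) (((m + 1 : ℕ) : ℝ) ^ 2) a)
    (WghAt (ctrHalf (m + 1)) (m + 1) (-1) (((m + 1 : ℕ) : ℝ) ^ 2) a)
  have e1 : PghQ (m + 1) a (-1) (((m + 1 : ℕ) : ℝ) ^ 2) a μ ν z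
      = hessKer (Ggh (m + 1) a)
          (fun μ y => ∑ κ : Fin 4, wsum (colH (KInvStep (d := 3) (m + 1) 0) (m + 1) μ y κ) (SghAt (ctrHalf (m + 1)) (m + 1) (((m + 1 : ℕ) : ℝ) ^ 2) a κ))
          (fun μ y ν y' => ∑ κ : Fin 4, ∑ l : Fin 4, wsum (colH (KInvStep (d := 3) (m + 1) 0) (m + 1) μ y κ)
            (fun u => wsum (colH (KInvStep (d := 3) (m + 1) 0) (m + 1) ν y' l) (WghAt (ctrHalf (m + 1)) (m + 1) (-1) (((m + 1 : ℕ) : ℝ) ^ 2) a κ u l))) μ ν z := by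
    rw [GhostKernelComplete.PghQ_eq]
    exact (congrFun (congrFun (congrFun hFull μ) ν) z).symm
  -- the `D*D`-only undressed word is `PghQ … 0` (at `cQ = 0` the completed stencil ∕ table ARE the `D*D` jets)
  have hS0 : SghAt (ctrHalf (m + 1)) (m + 1) (((m + 1 : ℕ) : ℝ) ^ 2) 0 = fun κ u => (((m + 1 : ℕ) : ℝ) ^ 2) • ghCur κ u := by
    funext κ u x z' p q
    rw [GhostStencilRooted.SghAt_apply, Pi.smul_apply, Pi.smul_apply, Pi.smul_apply, Pi.smul_apply, smul_eq_mul, zero_mul, add_zero]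
  have hW0 : WghAt (ctrHalf (m + 1)) (m + 1) (-1) (((m + 1 : ℕ) : ℝ) ^ 2) 0 = diagExt (fun μ y => ((-1) * ((m + 1 : ℕ) : ℝ) ^ 2) • ghX μ y) := by
    funext κ v l v'
    rw [GhostAveragingSquare.WghAt_eq, mul_zero, zero_mul, neg_zero, zero_smul, add_zero]
  have hD := hessKer_K₀_packed_eq_TOfGh (m + 1) a (fun κ u => (((m + 1 : ℕ) : ℝ) ^ 2) • ghCur κ u)
    (diagExt (fun μ y => ((-1) * ((m + 1 : ℕ) : ℝ) ^ 2) • ghX μ y))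
  have e2 : PghQ (m + 1) a (-1) (((m + 1 : ℕ) : ℝ) ^ 2) 0 μ ν z
      = hessKer (Ggh (m + 1) a)
          (fun μ y => ∑ κ : Fin 4, wsum (colH (KInvStep (d := 3) (m + 1) 0) (m + 1) μ y κ) (fun u => (((m + 1 : ℕ) : ℝ) ^ 2) • ghCur κ u))
          (fun μ y ν y' => ∑ κ : Fin 4, ∑ l : Fin 4, wsum (colH (KInvStep (d := 3) (m + 1) 0) (m + 1) μ y κ)
            (fun u => wsum (colH (KInvStep (d := 3) (m + 1) 0) (m + 1) ν y' l)
              (diagExt (fun μ y => ((-1) * ((m + 1 : ℕ) : ℝ) ^ 2) • ghX μ y) κ u l))) μ ν z := by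
    rw [GhostKernelComplete.PghQ_eq, hS0, hW0]
    exact (congrFun (congrFun (congrFun hD μ) ν) z).symm
  linarith [hK, e1, e2]


end Summit.QuantumFields.BalabanUV.Beta.D1BFx.GhostBracketGaugeSplit

end
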